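import Literature.AlgebraicGeometry.Frobenioids.PadicKummerThm24iFrobenioidRelTheta
import HarnessLib

/-!
# Frobenioids II, Theorem 2.4 (i) over GENERAL bases: the inputs `e`, `compat` DERIVED from the 1-compatibility
# "`Ψ ⋙ Base ≅ Base ⋙ θ_*`" (a natural isomorphism of functors)

Mochizuki, *The geometry of Frobenioids II*, Kyushu J. Math. **62** (2008) 401–460, §2, Theorem 2.4 p. 19
[cite: MochizukiFrdII2008, Thm 2.4 (i) p.19]: "an equivalence of categories `Ψ : C₁ ⥲ C₂` — which … necessarily induces a
1-compatible equivalence of categories `Ψ_Base : D₁ ⥲ D₂`, hence an outer isomorphism of topological groups `Π₁ ⥲ Π₂`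
[cf. [Mzk2], Proposition 3.2] that lies over an outer isomorphism of topological groups `G₁ ⥲ G₂` [cf. Theorem 1.2, (ii)].
Assume that this isomorphism `G₁ ⥲ G₂` maps `H₁` onto `H₂`. Then … (i) …".

Sequel (seat abc-iut-L1-t7, gen 6) to `PadicKummerThm24iFrobenioidRelTheta.lean` (gen 5: Thm. 2.4 (i) over the general §2
bases `Dᵢ = B^temp(Πᵢ, Πᵢ°)⁰`, small model `RelCosetCat Πᵢ°`, modulo EXACTLY {hO, `θ`/`hkerθ`, `e`/`compat`, map_H, hfs}, where
`e : θ_*((A₁)_D) ≅ (Ψ A₁)_D` and `compat` — "`Base((Ψα)⁻¹) = e⁻¹ ≫ θ_*(Base(α⁻¹)) ≫ e` for `α ∈ Aut(A₁)`" — were free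
PER-OBJECT data).  Here the per-object data are DERIVED from the printed global statement, a natural isomorphism of functors
`C₁ ⥤ B^temp(Π₂)⁰`

  `εF : Ψ ⋙ Base₂ ⋙ incl ≅ Base₁ ⋙ incl ⋙ θ_*`    ("`Ψ` induces `Ψ_Base`, and `Ψ_Base = θ_*`, 1-compatibly"):

* §1 `basePushIso` — `εF` assembled from its two printed halves: a functor `Ψ_Base : D₁ ⥤ D₂` with
  `η : Ψ ⋙ Base₂ ≅ Base₁ ⋙ Ψ_Base` ([FrdI] Thm. 3.4 (v) / [FrdII] Thm. 1.2 (i): "`Ψ` induces a 1-compatible `Ψ_Base`") and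
  `ε : incl ⋙ θ_* ≅ Ψ_Base ⋙ incl` ([SemiAnbd] Prop. 3.2 step; for `Ψ_Base` an EQUIVALENCE of the small bases of tempered
  Galois-countable `Πᵢ` this `ε`, with `θ` an isomorphism of topological groups, is CONSTRUCTED in
  `PadicFrobenioidBaseGaloisSystemPushIso.lean`, `BaseGaloisSystem.exists_hom_pushIso_of_relCosetCat_equivalence`);
* §2 `baseIsoOfPush A := (εF A)⁻¹` and **`baseMap_map_hom_eq`** — for EVERY morphism `f : A → A'` of `C₁`,
  `Base(Ψ f) = e_A⁻¹ ≫ θ_*(Base f) ≫ e_{A'}` (naturality of `εF`), in particular gen 5's `compat` (`compat_ofPush`);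
* §3 **`thm24i_ofFunctorRel_ofBasePush`** — Theorem 2.4 (i) over general bases modulo EXACTLY
  {hO "`Ψ` preserves `O^⊳`" ([FrdI] Cor. 4.10/4.11), `θ` continuous open surjective with `εF` (EXISTS by the file cited in
  §1 whenever `Ψ_Base` is an equivalence — print's hypothesis), `hkerθ` "`θ` lies over `G₁ ⥲ G₂`" ([FrdII] Thm. 1.2 (ii)),
  map_H (printed assumption), hfs (row L03)}.

Category-theoretic plumbing over landed files (no new mathematics beyond naturality bookkeeping); nothing here concerns
[IUTchIII]; no statement of the paper is strengthened.
-/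

noncomputable section

namespace Literature.AlgebraicGeometry.Frobenioids

namespace PadicFrd

namespace RelGal

open CategoryTheory Literature.AnabelianGeometry.SemiGraphs

/-! ### §1 Assembling `Ψ ⋙ Base₂ ⋙ incl ≅ Base₁ ⋙ incl ⋙ θ_*` from `Ψ_Base`, `η`, `ε` -/

section Assemble

variable {P₁ : Type} [Group P₁] [TopologicalSpace P₁] {P₁₀ : OpenSubgroup P₁}
  {P₂ : Type} [Group P₂] [TopologicalSpace P₂] {P₂₀ : OpenSubgroup P₂}
  {p₁ p₂ : ℕ} [Fact p₁.Prime] [Fact p₂.Prime]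
  {d₁ : Datum (RelCosetCat P₁₀) p₁} {d₂ : Datum (RelCosetCat P₂₀) p₂}
  (F : d₁.frobenioid ⥤ d₂.frobenioid) (ΨB : RelCosetCat P₁₀ ⥤ RelCosetCat P₂₀)
  (η : F ⋙ ModelFrobenioid.baseFunctor d₂.Φ d₂.B d₂.divB ≅ ModelFrobenioid.baseFunctor d₁.Φ d₁.B d₁.divB ⋙ ΨB)
  (θ : P₁ →* P₂) (hθo : IsOpenMap θ)
  (ε : RelCosetCat.incl P₁₀ ⋙ CosetCat.push θ hθo ≅ ΨB ⋙ RelCosetCat.incl P₂₀)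

/-- **`Ψ ⋙ Base₂ ⋙ incl ≅ Base₁ ⋙ incl ⋙ θ_*`** from "`Ψ` induces `Ψ_Base`" (`η`) and "`Ψ_Base = θ_*`" (`ε`), by whiskering.
[cite: MochizukiFrdII2008, Thm 2.4 (i) p.19] -/
def basePushIso :
    F ⋙ ModelFrobenioid.baseFunctor d₂.Φ d₂.B d₂.divB ⋙ RelCosetCat.incl P₂₀ ≅
      ModelFrobenioid.baseFunctor d₁.Φ d₁.B d₁.divB ⋙ RelCosetCat.incl P₁₀ ⋙ CosetCat.push θ hθo :=
  (Functor.associator _ _ _).symm ≪≫ Functor.isoWhiskerRight η (RelCosetCat.incl P₂₀) ≪≫ Functor.associator _ _ _ ≪≫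
    Functor.isoWhiskerLeft (ModelFrobenioid.baseFunctor d₁.Φ d₁.B d₁.divB) ε.symm

/-- Components of `basePushIso`: `(η_A)^incl ≫ ε⁻¹_{(A)_D}`. [cite: MochizukiFrdII2008, Thm 2.4 (i) p.19] -/
theorem basePushIso_hom_app (A : d₁.frobenioid) :
    (basePushIso F ΨB η θ hθo ε).hom.app A = (η.hom.app A).hom ≫ ε.inv.app A.base := by
  simp [basePushIso]
  erw [Category.id_comp, Category.id_comp]

end Assemble

/-! ### §2 `e` and `compat` from `εF : Ψ ⋙ Base₂ ⋙ incl ≅ Base₁ ⋙ incl ⋙ θ_*` -/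

section BasePush

variable {P₁ : Type} [Group P₁] [TopologicalSpace P₁] {P₁₀ : OpenSubgroup P₁}
  {P₂ : Type} [Group P₂] [TopologicalSpace P₂] {P₂₀ : OpenSubgroup P₂}
  {p₁ p₂ : ℕ} [Fact p₁.Prime] [Fact p₂.Prime]
  {d₁ : Datum (RelCosetCat P₁₀) p₁} {d₂ : Datum (RelCosetCat P₂₀) p₂}
  (F : d₁.frobenioid ⥤ d₂.frobenioid) (θ : P₁ →* P₂) (hθo : IsOpenMap θ)
  (εF : F ⋙ ModelFrobenioid.baseFunctor d₂.Φ d₂.B d₂.divB ⋙ RelCosetCat.incl P₂₀ ≅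
    ModelFrobenioid.baseFunctor d₁.Φ d₁.B d₁.divB ⋙ RelCosetCat.incl P₁₀ ⋙ CosetCat.push θ hθo)

/-- **The isomorphism `e_A : θ_*((A)_D) ≅ (Ψ A)_D`** in `B^temp(Π₂)⁰`, for EVERY object `A` (gen 5's free input `e`).
[cite: MochizukiFrdII2008, Thm 2.4 (i) p.19] -/
def baseIsoOfPush (A : d₁.frobenioid) : (CosetCat.push θ hθo).obj A.base.obj ≅ (F.obj A).base.obj := (εF.app A).symm

/-- `(e_A).hom = εF⁻¹_A`. [cite: MochizukiFrdII2008, Thm 2.4 (i) p.19] -/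
@[simp] theorem baseIsoOfPush_hom (A : d₁.frobenioid) : (baseIsoOfPush F θ hθo εF A).hom = εF.inv.app A := rfl

/-- `(e_A).inv = εF_A`. [cite: MochizukiFrdII2008, Thm 2.4 (i) p.19] -/
@[simp] theorem baseIsoOfPush_inv (A : d₁.frobenioid) : (baseIsoOfPush F θ hθo εF A).inv = εF.hom.app A := rfl

/-- **`Base(Ψ f) = e_A⁻¹ ≫ θ_*(Base f) ≫ e_{A'}`** for every morphism `f : A → A'` of `C₁` — the naturality of `εF` read as the
1-compatibility of `Ψ` with `θ_*`. [cite: MochizukiFrdII2008, Thm 2.4 (i) p.19] -/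
theorem baseMap_map_hom_eq {A A' : d₁.frobenioid} (f : A ⟶ A') :
    (ModelFrobenioid.baseMap (F.map f)).hom =
      (baseIsoOfPush F θ hθo εF A).inv ≫ (CosetCat.push θ hθo).map (ModelFrobenioid.baseMap f).hom ≫
        (baseIsoOfPush F θ hθo εF A').hom := by
  have h : (ModelFrobenioid.baseMap (F.map f)).hom ≫ (εF.app A').hom =
      εF.hom.app A ≫ (CosetCat.push θ hθo).map (ModelFrobenioid.baseMap f).hom := εF.hom.naturality f
  rw [baseIsoOfPush_inv, baseIsoOfPush_hom, ← Category.assoc]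
  exact (Iso.eq_comp_inv (εF.app A')).mpr h

/-- **gen 5's `compat`, DERIVED**: `Base((Ψα)⁻¹) = e⁻¹ ≫ θ_*(Base(α⁻¹)) ≫ e` for `α ∈ Aut(A)`. [cite: MochizukiFrdII2008, Thm 2.4 (i) p.19] -/
theorem compat_ofPush (A : d₁.frobenioid) (α : Aut A) :
    (ModelFrobenioid.baseMap (F.mapIso α).inv).hom =
      (baseIsoOfPush F θ hθo εF A).inv ≫ (CosetCat.push θ hθo).map (ModelFrobenioid.baseMap α.inv).hom ≫
        (baseIsoOfPush F θ hθo εF A).hom :=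
  baseMap_map_hom_eq F θ hθo εF α.inv

end BasePush

end RelGal

end PadicFrd

/-! ### §3 Theorem 2.4 (i) over general bases from `θ` and the natural isomorphism `εF` -/

namespace PadicKummer.Def22Context

open CategoryTheory Field IntermediateField Kummer Function
open Literature.NumberTheory.GaloisRepresentations
open Literature.AnabelianGeometry.SemiGraphs QuasiTemperoid PadicFrd PadicFrd.Datum PadicFrd.Datum.GaloisChart PadicFrd.RelGal

variable {p₁ p₂ : ℕ} [Fact p₁.Prime] [Fact p₂.Prime]
  {P₁ : Type} [Group P₁] [TopologicalSpace P₁] {φ₁ : P₁ →* GalFbar ℚ_[p₁]} {hφ₁ : IsOpenHom φ₁} {P₁₀ : OpenSubgroup P₁}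
  {d₁ : PadicFrd.Datum (RelCosetCat P₁₀) p₁} (hd₁ : d₁.base = relBaseGal p₁ P₁₀ φ₁ hφ₁)
  {P₂ : Type} [Group P₂] [TopologicalSpace P₂] {φ₂ : P₂ →* GalFbar ℚ_[p₂]} {hφ₂ : IsOpenHom φ₂} {P₂₀ : OpenSubgroup P₂}
  {d₂ : PadicFrd.Datum (RelCosetCat P₂₀) p₂} (hd₂ : d₂.base = relBaseGal p₂ P₂₀ φ₂ hφ₂)
  (F : d₁.frobenioid ⥤ d₂.frobenioid) [F.Full] [F.Faithful] {A₁ : d₁.frobenioid}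
  (hA₁ : A₁.base.obj.sg.toSubgroup.Normal) (hA₂ : (F.obj A₁).base.obj.sg.toSubgroup.Normal)
  (hO : ∀ f : A₁ ⟶ A₁, f ∈ PreFrobenioid.endSubmonoid d₁.structureFunctor A₁ ↔
    F.map f ∈ PreFrobenioid.endSubmonoid d₂.structureFunctor (F.obj A₁))
  (θ : P₁ →* P₂) (hθc : Continuous θ) (hθo : IsOpenMap θ) (hθs : Surjective θ)
  (hkerθ : ∀ x : P₁, φ₁ x = 1 ↔ φ₂ (θ x) = 1)
  (εF : F ⋙ ModelFrobenioid.baseFunctor d₂.Φ d₂.B d₂.divB ⋙ RelCosetCat.incl P₂₀ ≅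
    ModelFrobenioid.baseFunctor d₁.Φ d₁.B d₁.divB ⋙ RelCosetCat.incl P₁₀ ⋙ CosetCat.push θ hθo)
  {H₁ : Subgroup (absoluteGaloisGroup (baseFld p₁ φ₁ hφ₁))} [H₁.Normal]
  {hH₁ : IsOpen (H₁ : Set (absoluteGaloisGroup (baseFld p₁ φ₁ hφ₁)))}
  {H₂ : Subgroup (absoluteGaloisGroup (baseFld p₂ φ₂ hφ₂))} [H₂.Normal]
  {hH₂ : IsOpen (H₂ : Set (absoluteGaloisGroup (baseFld p₂ φ₂ hφ₂)))}
  (map_H : H₁.map (isoGOfTheta φ₁ hφ₁ φ₂ hφ₂ F θ hθc hθo hθs hkerθ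
    (baseIsoOfPush F θ hθo εF A₁)).toMulEquiv.toMonoidHom = H₂)
  (N : ℕ) [NeZero N]
  (hμ₁ : ∀ ζ : rootsOfUnity N (AlgebraicClosure (baseFld p₁ φ₁ hφ₁)),
    ((ζ : (AlgebraicClosure (baseFld p₁ φ₁ hφ₁))ˣ) : AlgebraicClosure (baseFld p₁ φ₁ hφ₁)) ∈ objL φ₁ hφ₁ d₁ A₁)
  (hμ₂ : ∀ ζ : rootsOfUnity N (AlgebraicClosure (baseFld p₂ φ₂ hφ₂)),
    ((ζ : (AlgebraicClosure (baseFld p₂ φ₂ hφ₂))ˣ) : AlgebraicClosure (baseFld p₂ φ₂ hφ₂)) ∈ objL φ₂ hφ₂ d₂ (F.obj A₁))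

/-- **The isomorphism of Definition 2.2 contexts of `A₁`, `Ψ A₁` induced by `Ψ`, from `θ` and `εF`** (`isoOfFunctorRelTheta`
with `e := baseIsoOfPush`, `compat := compat_ofPush`). [cite: MochizukiFrdII2008, Thm 2.4 (i) p.19] -/
def isoOfFunctorRelBasePush :
    (contextOfObjectRel φ₁ hφ₁ d₁ hd₁ A₁ hA₁ H₁ hH₁).Iso (contextOfObjectRel φ₂ hφ₂ d₂ hd₂ (F.obj A₁) hA₂ H₂ hH₂) :=
  isoOfFunctorRelTheta hd₁ hd₂ F hA₁ hA₂ hO θ hθc hθo hθs hkerθ (baseIsoOfPush F θ hθo εF A₁)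
    (compat_ofPush F θ hθo εF A₁) map_H

/-- **[FrdII] Theorem 2.4 (i) for the `p`-adic Frobenioids over GENERAL bases `Dᵢ = B^temp(Πᵢ, Πᵢ°)⁰`, the 1-compatibility
"`Ψ_Base = θ_*`" given as a NATURAL ISOMORPHISM `εF : Ψ ⋙ Base₂ ⋙ incl ≅ Base₁ ⋙ incl ⋙ θ_*`.**  For `Ψ : C₁ ⥤ C₂` fully
faithful, `A₁` with `(A₁)_D`, `(Ψ A₁)_D` Galois, `μ_N(K̄ᵢ) ⊆ Lᵢ`, `A₁` `(N, H₁)`-saturated, any normalisation `F_N(A₁) ≅ ℤ/N`, and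
BY NAME: hO "`Ψ` preserves `O^⊳(−)`" ([FrdI] Cor. 4.10/4.11); a continuous open surjective `θ : Π₁ ↠ Π₂` lying over the `G`'s
(`hkerθ`, [FrdII] Thm. 1.2 (ii)) with `εF` ("`Ψ` … induces a 1-compatible … `Ψ_Base` … hence … `Π₁ ⥲ Π₂` [[Mzk2] Prop. 3.2]" —
`εF` with such a `θ`, even a homeomorphism, EXISTS whenever `Ψ_Base` is an equivalence of the small bases:
`BaseGaloisSystem.exists_hom_pushIso_of_relCosetCat_equivalence` + `basePushIso`); map_H (printed assumption, for the
representative `isoGOfTheta`); hfs (row L03) — the typed `Thm24i` holds for the contexts of `A₁`, `Ψ A₁`, the comparison data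
induced by `Ψ`, and the cup-product duality isomorphisms; `e`, `compat`, `isoG`, `houter`, `hbase`, `p₁ = p₂`, local
compactness, the saturation transfer and the Kummer/reciprocity compatibilities are all CONSTRUCTED or PROVED.
[cite: MochizukiFrdII2008, Thm 2.4 (i) p.19] -/
theorem thm24i_ofFunctorRel_ofBasePush (fs₁ fs₂ : Prop) (hfs : fs₁ ↔ fs₂)
    (eFN₁ : FN (contextOfObjectRel φ₁ hφ₁ d₁ hd₁ A₁ hA₁ H₁ hH₁) N ≃+ ZMod N)
    (hc₁ : IsNHSaturated (contextOfObjectRel φ₁ hφ₁ d₁ hd₁ A₁ hA₁ H₁ hH₁) N) :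
    haveI := finiteDimensional_objL φ₁ hφ₁ d₁ A₁; haveI := normal_objL φ₁ hφ₁ d₁ A₁ hA₁
    haveI := finiteDimensional_objL φ₂ hφ₂ d₂ (F.obj A₁); haveI := normal_objL φ₂ hφ₂ d₂ (F.obj A₁) hA₂
    haveI := finiteDimensional_baseFld p₁ φ₁ hφ₁; haveI := finiteDimensional_baseFld p₂ φ₂ hφ₂
    haveI := locallyCompactSpace_H_contextOfObjectRel φ₁ hφ₁ d₁ hd₁ A₁ hA₁ H₁ hH₁
    haveI := locallyCompactSpace_H_contextOfObjectRel φ₂ hφ₂ d₂ hd₂ (F.obj A₁) hA₂ H₂ hH₂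
    letI := (galoisChartRel φ₁ hφ₁ d₁ hd₁ A₁ hA₁).galAction
    letI := (galoisChartRel φ₂ hφ₂ d₂ hd₂ (F.obj A₁) hA₂).galAction
    Thm24i (contextOfObjectRel φ₁ hφ₁ d₁ hd₁ A₁ hA₁ H₁ hH₁) (contextOfObjectRel φ₂ hφ₂ d₂ hd₂ (F.obj A₁) hA₂ H₂ hH₂)
      N p₁ p₂ fs₁ fs₂
      ((isoOfFunctorRelBasePush hd₁ hd₂ F hA₁ hA₂ hO θ hθc hθo hθs hkerθ εF map_H).thm24Data N)
      ((contextOfObjectRel φ₁ hφ₁ d₁ hd₁ A₁ hA₁ H₁ hH₁).dualityIsoOfLocalDuality N eFN₁ hc₁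
        (cupDualH_bijective_ofGalois_mlf p₁ (objL φ₁ hφ₁ d₁ A₁) H₁ hH₁ (galoisChartRel φ₁ hφ₁ d₁ hd₁ A₁ hA₁).res
          (galoisChartRel φ₁ hφ₁ d₁ hd₁ A₁ hA₁).res_smul ((galoisChartRel φ₁ hφ₁ d₁ hd₁ A₁ hA₁).muModel N hμ₁)))
      ((contextOfObjectRel φ₂ hφ₂ d₂ hd₂ (F.obj A₁) hA₂ H₂ hH₂).dualityIsoOfLocalDuality N
        (((isoOfFunctorRelBasePush hd₁ hd₂ F hA₁ hA₂ hO θ hθc hθo hθs hkerθ εF map_H).isoFN N).symm.trans eFN₁)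
        (((isoOfFunctorRelBasePush hd₁ hd₂ F hA₁ hA₂ hO θ hθc hθo hθs hkerθ εF map_H).isNHSaturated_iff N).mp hc₁)
        (cupDualH_bijective_ofGalois_mlf p₂ (objL φ₂ hφ₂ d₂ (F.obj A₁)) H₂ hH₂
          (galoisChartRel φ₂ hφ₂ d₂ hd₂ (F.obj A₁) hA₂).res (galoisChartRel φ₂ hφ₂ d₂ hd₂ (F.obj A₁) hA₂).res_smul
          ((galoisChartRel φ₂ hφ₂ d₂ hd₂ (F.obj A₁) hA₂).muModel N hμ₂))) :=
  thm24i_ofFunctorRel_ofTheta hd₁ hd₂ F hA₁ hA₂ hO θ hθc hθo hθs hkerθ (baseIsoOfPush F θ hθo εF A₁)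
    (compat_ofPush F θ hθo εF A₁) map_H N hμ₁ hμ₂ fs₁ fs₂ hfs eFN₁ hc₁

end PadicKummer.Def22Context

end Literature.AlgebraicGeometry.Frobenioids

end
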